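import Literature.NumberTheory.Automorphic.UnitaryGroupBorelInduction
import Literature.NumberTheory.Automorphic.ParabolicInductionAdmissibleProofs
import Literature.RepresentationTheory.IrreducibleTwistTransport
import HarnessLib

/-!
# Pull-back (`comap`) of irreducible smooth representations and of their isomorphism classes along an
# isomorphism of topological groups, and CONSTITUENT TRANSPORT by name

For an isomorphism of topological groups `e : G′ ≃ₜ* G`:

* `SmoothIrrep.comap e r` — the irreducible smooth representation `r ∘ e` of `G′` (same space, action `g′ ↦ r.ρ (e g′)`;
  irreducible by ★ `Representation.IsIrreducible.comp_of_surjective`, smooth by ★ `Representation.IsSmooth.comp`);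
* `IrrClass.comap e : Irr(G) → Irr(G′)`, `⟦r⟧ ↦ ⟦r ∘ e⟧`, with `comap_mk` (`rfl`), `comap_comap_symm`, `comap_symm_comap`,
  `comap_surjective`, `comap_injective`, `comap_bijective`, and the bijection `IrrClass.comapEquiv e : Irr(G) ≃ Irr(G′)`;
* §2 **constituent transport**: `(IrrClass.comap e c).IsConstituentOf (ρ.comp e) ↔ c.IsConstituentOf ρ` for every complex
  representation `ρ` of `G` (★ `IrrClass.IsConstituentOf`, `Automorphic/UnitaryGroupBorelInduction` §5).

This is the typ3 round-2 item **P1** of the F0∕P3 programme (cell `hodgecm-mathlib`, crux H413, F0P3-plan (g3) PLAN §15,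
p04 (g4) memo `TYP3-SIGNATURES-D5D6` §2): the line `Cruxes/H413/Lines/F0_LocalAPackets.lean` (P3b, ED 4.1) carries LINE-LOCAL
copies `pullbackIrrep` ∕ `pullbackClass` whose docstrings announce the re-pointing onto `IrrClass.comap` «by `rfl`»; the bodies
below are those bodies VERBATIM, so `pullbackIrrep e = SmoothIrrep.comap e` and `pullbackClass e = IrrClass.comap e` hold by
`rfl`, and ★ `Theorems/F0P3bStubConstituentTransport.stubConstituentTransport_holds` (stated for the UNFOLDED structure literal)
is §2's `comap_isConstituentOf_comp_iff` by `rfl` as well (its proof is repeated here because `Literature/` cannot import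
`Summits/…/Theorems/`).  Consumers: D6 `LocalConstituentsIn` (local constituents of a discrete automorphic representation moved
along ★ `UnitaryGroup.localPiEquiv v`), the split ∕ non-split local A-packets of an inner form (`cmSplitPacket`,
`cmNonsplitPacket`, to be promoted as `Rogawski1990/CMLocalAPacketMembers.lean`).

Design: a single universe `u` for `G, G′` exactly as ★ `SmoothIrrep` ∕ `IrrClass` (`Automorphic/IrreducibleClasses`); no
instance, no notation, no named fact.  NOT here: functoriality in `e` beyond `refl`∕`symm` (not needed by any consumer),
transport of central characters ∕ supercuspidality ∕ square-integrability (the last is ★ `isSquareIntegrable_mk_iff` in the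
P3b line and ★ `Representation.IsSquareIntegrableModCenter.of_equiv`).

## References
[BushnellHenniart2006] §1.1–§1.2 (the set `Irr(G)`; equivalence of representations), §2 · [Rogawski1990] §12.2 p. 173
(constituents of `i_G(χ)`), §13.1 p. 199 (local components `π_v` of `π = ⊗ π_v`).
HC_CM is proved only modulo the printed citations until rung 0 closes.
-/

set_option autoImplicit false

noncomputable section

namespace Literature.NumberTheory.Automorphic

universe u

/-! ## §1 `comap` on `SmoothIrrep` and on `IrrClass` -/

namespace SmoothIrrep

variable {G G' : Type u} [Group G] [TopologicalSpace G] [Group G'] [TopologicalSpace G']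

/-- **Pull-back `r ∘ e` of an irreducible smooth representation along an isomorphism of topological groups
`e : G′ ≃ₜ* G`**: the same space `r.V` with the action `g′ ↦ r.ρ (e g′)`; irreducible because `e` is onto
(★ `IsIrreducible.comp_of_surjective`), smooth because `e` is continuous (★ `IsSmooth.comp`).  Body = the P3b line's
`pullbackIrrep` verbatim. [cite: BushnellHenniart2006, §1.1] -/
def comap (e : G' ≃ₜ* G) (r : SmoothIrrep G) : SmoothIrrep G' where
  V := r.V
  ρ := r.ρ.comp (e : G' →* G)
  isIrreducible := r.isIrreducible.comp_of_surjective (e : G' →* G) e.surjective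
  isSmooth := r.isSmooth.comp (e : G' →* G) e.continuous

/-- The space of `r ∘ e` is the space of `r`. [cite: BushnellHenniart2006, §1.1] -/
theorem comap_V (e : G' ≃ₜ* G) (r : SmoothIrrep G) : (r.comap e).V = r.V := rfl

/-- The action of `r ∘ e` is `r.ρ ∘ e`. [cite: BushnellHenniart2006, §1.1] -/
theorem comap_ρ (e : G' ≃ₜ* G) (r : SmoothIrrep G) : (r.comap e).ρ = r.ρ.comp (e : G' →* G) := rfl

/-- The action of `r ∘ e` at `g′` is `r.ρ (e g′)`. [cite: BushnellHenniart2006, §1.1] -/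
theorem comap_ρ_apply (e : G' ≃ₜ* G) (r : SmoothIrrep G) (g' : G') : (r.comap e).ρ g' = r.ρ (e g') := rfl

/-- **Pull-backs of isomorphic irreducibles are isomorphic** (the same linear isomorphism intertwines `r₁ ∘ e` and
`r₂ ∘ e`); this is the well-definedness of `IrrClass.comap`. [cite: BushnellHenniart2006, §1.1] -/
theorem comap_equiv (e : G' ≃ₜ* G) {r₁ r₂ : SmoothIrrep G} (h : r₁ ≈ r₂) : r₁.comap e ≈ r₂.comap e := by
  obtain ⟨φ⟩ := (SmoothIrrep.equiv_iff r₁ r₂).1 h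
  exact (SmoothIrrep.equiv_iff _ _).2 ⟨Representation.Equiv.mk φ.toLinearEquiv fun g' => φ.isIntertwining' (e g')⟩

/-- `(r ∘ e⁻¹) ∘ e ≅ r` (identity linear isomorphism; the operators are `r.ρ (e⁻¹ (e g′)) = r.ρ g′`). [cite: BushnellHenniart2006, §1.1] -/
theorem comap_comap_symm_equiv (e : G' ≃ₜ* G) (r : SmoothIrrep G') : (r.comap e.symm).comap e ≈ r := by
  refine (SmoothIrrep.equiv_iff _ _).2 ⟨Representation.Equiv.mk (LinearEquiv.refl ℂ r.V) fun g' => ?_⟩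
  refine LinearMap.ext fun v => ?_
  change r.ρ (e.symm (e g')) v = r.ρ g' v
  rw [ContinuousMulEquiv.symm_apply_apply]

/-- `(r ∘ e) ∘ e⁻¹ ≅ r` (identity linear isomorphism; the operators are `r.ρ (e (e⁻¹ g)) = r.ρ g`). [cite: BushnellHenniart2006, §1.1] -/
theorem comap_symm_comap_equiv (e : G' ≃ₜ* G) (r : SmoothIrrep G) : (r.comap e).comap e.symm ≈ r := by
  refine (SmoothIrrep.equiv_iff _ _).2 ⟨Representation.Equiv.mk (LinearEquiv.refl ℂ r.V) fun g => ?_⟩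
  refine LinearMap.ext fun v => ?_
  change r.ρ (e (e.symm g)) v = r.ρ g v
  rw [ContinuousMulEquiv.apply_symm_apply]

end SmoothIrrep

namespace IrrClass

variable {G G' : Type u} [Group G] [TopologicalSpace G] [Group G'] [TopologicalSpace G']

/-- **Pull-back of isomorphism classes along `e : G′ ≃ₜ* G`**, `Irr(G) → Irr(G′)`, `⟦r⟧ ↦ ⟦r ∘ e⟧` (well defined by
`SmoothIrrep.comap_equiv`).  Body = the P3b line's `pullbackClass` verbatim (so `pullbackClass e = IrrClass.comap e` is `rfl`).
«If `π` is a representation of `G` and `e : G′ → G` an isomorphism, `π ∘ e` is a representation of `G′` whose class depends only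
on the class of `π`.» [cite: BushnellHenniart2006, §1.1] -/
def comap (e : G' ≃ₜ* G) : IrrClass G → IrrClass G' :=
  Quotient.map (SmoothIrrep.comap e) fun _ _ h => SmoothIrrep.comap_equiv e h

/-- `comap e ⟦r⟧ = ⟦r ∘ e⟧` (definitional). [cite: BushnellHenniart2006, §1.1] -/
theorem comap_mk (e : G' ≃ₜ* G) (r : SmoothIrrep G) : comap e (IrrClass.mk r) = IrrClass.mk (r.comap e) := rfl

/-- `comap e ∘ comap e⁻¹ = id` on `Irr(G′)`. [cite: BushnellHenniart2006, §1.1] -/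
theorem comap_comap_symm (e : G' ≃ₜ* G) (c : IrrClass G') : comap e (comap e.symm c) = c := by
  induction c using Quotient.inductionOn with
  | h r => exact Quotient.sound (SmoothIrrep.comap_comap_symm_equiv e r)

/-- `comap e⁻¹ ∘ comap e = id` on `Irr(G)`. [cite: BushnellHenniart2006, §1.1] -/
theorem comap_symm_comap (e : G' ≃ₜ* G) (c : IrrClass G) : comap e.symm (comap e c) = c := by
  induction c using Quotient.inductionOn with
  | h r => exact Quotient.sound (SmoothIrrep.comap_symm_comap_equiv e r)

/-- `comap e : Irr(G) → Irr(G′)` is onto (right inverse `comap e⁻¹`). [cite: BushnellHenniart2006, §1.1] -/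
theorem comap_surjective (e : G' ≃ₜ* G) : Function.Surjective (comap e) :=
  fun c => ⟨comap e.symm c, comap_comap_symm e c⟩

/-- `comap e : Irr(G) → Irr(G′)` is one-to-one (left inverse `comap e⁻¹`). [cite: BushnellHenniart2006, §1.1] -/
theorem comap_injective (e : G' ≃ₜ* G) : Function.Injective (comap e) :=
  fun c₁ c₂ h => by rw [← comap_symm_comap e c₁, ← comap_symm_comap e c₂, h]

/-- `comap e : Irr(G) → Irr(G′)` is a bijection. [cite: BushnellHenniart2006, §1.1] -/
theorem comap_bijective (e : G' ≃ₜ* G) : Function.Bijective (comap e) :=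
  ⟨comap_injective e, comap_surjective e⟩

/-- **The bijection `Irr(G) ≃ Irr(G′)` induced by an isomorphism of topological groups `e : G′ ≃ₜ* G`** (forward map
`comap e`, inverse `comap e⁻¹`). «An isomorphism of groups identifies the sets `Irr`.» [cite: BushnellHenniart2006, §1.1] -/
def comapEquiv (e : G' ≃ₜ* G) : IrrClass G ≃ IrrClass G' where
  toFun := comap e
  invFun := comap e.symm
  left_inv := comap_symm_comap e
  right_inv := comap_comap_symm e

/-- The forward map of `comapEquiv e` is `comap e`. [cite: BushnellHenniart2006, §1.1] -/
theorem comapEquiv_apply (e : G' ≃ₜ* G) (c : IrrClass G) : comapEquiv e c = comap e c := rfl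

/-- The inverse map of `comapEquiv e` is `comap e⁻¹`. [cite: BushnellHenniart2006, §1.1] -/
theorem comapEquiv_symm_apply (e : G' ≃ₜ* G) (c : IrrClass G') : (comapEquiv e).symm c = comap e.symm c := rfl

/-- A class of `G′` is a pull-back along `e` of a class satisfying `P` iff its push-forward `comap e⁻¹` satisfies `P`
(bookkeeping for «the members of the pulled-back packet are exactly the pull-backs of …»). [cite: BushnellHenniart2006, §1.1] -/
theorem exists_eq_comap_iff (e : G' ≃ₜ* G) (P : IrrClass G → Prop) (c : IrrClass G') :
    (∃ c₀ : IrrClass G, c = comap e c₀ ∧ P c₀) ↔ P (comap e.symm c) := by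
  constructor
  · rintro ⟨c₀, rfl, h⟩
    rwa [comap_symm_comap]
  · intro h
    exact ⟨comap e.symm c, (comap_comap_symm e c).symm, h⟩

end IrrClass

/-! ## §2 Constituent transport along `e : G′ ≃ₜ* G` -/

/-- `(ρ ∘ e) ∘ e⁻¹ = ρ`.  (Declared by its absolute name as a dot-notation extension of Mathlib's `Representation`;
the statement mentions only Mathlib's `MonoidHom.comp` and `ContinuousMulEquiv`.  It RESTATES ★
`Summit.….F0P3bStubConstituentTransport.comp_coe_comp_coe_symm` token for token — that copy lives under `Summits/…/Theorems/`,
which `Literature/` cannot import; the Theorems copy can be re-pointed onto this one.) [cite: BushnellHenniart2006, §1.1] -/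
theorem _root_.Representation.comp_coe_comp_coe_symm {G G' : Type u} [Group G] [TopologicalSpace G] [Group G']
    [TopologicalSpace G'] (e : G' ≃ₜ* G) {V : Type*} [AddCommGroup V] [Module ℂ V] (ρ : Representation ℂ G V) :
    (ρ.comp (e : G' →* G)).comp (e.symm : G →* G') = ρ := by
  refine MonoidHom.ext fun g => ?_
  change ρ (e (e.symm g)) = ρ g
  rw [ContinuousMulEquiv.apply_symm_apply]

/-- `(ρ ∘ e⁻¹) ∘ e = ρ`. [cite: BushnellHenniart2006, §1.1] -/
theorem _root_.Representation.comp_coe_symm_comp_coe {G G' : Type u} [Group G] [TopologicalSpace G] [Group G']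
    [TopologicalSpace G'] (e : G' ≃ₜ* G) {V : Type*} [AddCommGroup V] [Module ℂ V] (ρ : Representation ℂ G' V) :
    (ρ.comp (e.symm : G →* G')).comp (e : G' →* G) = ρ := by
  refine MonoidHom.ext fun g' => ?_
  change ρ (e.symm (e g')) = ρ g'
  rw [ContinuousMulEquiv.symm_apply_apply]

namespace IrrClass

variable {G G' : Type u} [Group G] [TopologicalSpace G] [Group G'] [TopologicalSpace G']

/-- **(⇐) Constituents pull back**: if `c` is a constituent of `ρ` then `comap e c = ⟦c ∘ e⟧` is a constituent of `ρ ∘ e` —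
the `G`-stable subspaces `N₂ ≤ N₁` are `G′`-stable for `ρ ∘ e`, the subquotient representation on `N₁ ⁄ N₂` is definitionally
`(N₁ ⁄ N₂) ∘ e`, and the isomorphism `r ≅ N₁ ⁄ N₂` intertwines `r ∘ e` with it (proof = ★ `F0P3bStubConstituentTransport`
§3, on the named def). [cite: Rogawski1990, §12.2 p. 173] -/
theorem IsConstituentOf.comap (e : G' ≃ₜ* G) {V : Type*} [AddCommGroup V] [Module ℂ V] {ρ : Representation ℂ G V}
    {c : IrrClass G} (h : c.IsConstituentOf ρ) : (comap e c).IsConstituentOf (ρ.comp (e : G' →* G)) := by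
  obtain ⟨r₀, hr₀, N₁, N₂, hle, ⟨φ⟩⟩ := h
  subst hr₀
  refine ⟨r₀.comap e, rfl, ⟨N₁.toSubmodule, fun g' _ hv => N₁.apply_mem_toSubmodule (e g') hv⟩,
    ⟨N₂.toSubmodule, fun g' _ hv => N₂.apply_mem_toSubmodule (e g') hv⟩, fun v hv => hle hv, ⟨?_⟩⟩
  exact Representation.Equiv.mk φ.toLinearEquiv fun g' => φ.isIntertwining' (e g')

/-- **CONSTITUENT TRANSPORT along an isomorphism of topological groups**: for `e : G′ ≃ₜ* G`, a complex representation `ρ`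
of `G` and a class `c ∈ Irr(G)`, `⟦c ∘ e⟧` is a constituent of `ρ ∘ e` iff `c` is a constituent of `ρ` ((⇒) is (⇐) for `e⁻¹`
at `ρ ∘ e`, read through `comap_symm_comap` and `(ρ ∘ e) ∘ e⁻¹ = ρ`).  This is ★
`Theorems/F0P3bStubConstituentTransport.stubConstituentTransport_holds` BY NAME on `IrrClass.comap` (that theorem states it for
the unfolded structure literal; the two agree by `rfl`).  «The map `π ↦ π ∘ e` identifies `JH(i_G(χ))` with `JH(i_{G′}(χ ∘ e))`.»
[cite: Rogawski1990, §12.2 p. 173] -/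
theorem comap_isConstituentOf_comp_iff (e : G' ≃ₜ* G) {V : Type*} [AddCommGroup V] [Module ℂ V]
    (ρ : Representation ℂ G V) (c : IrrClass G) :
    (comap e c).IsConstituentOf (ρ.comp (e : G' →* G)) ↔ c.IsConstituentOf ρ := by
  refine ⟨fun h => ?_, fun h => h.comap e⟩
  have h' := h.comap e.symm
  rwa [comap_symm_comap, Representation.comp_coe_comp_coe_symm] at h'

/-- The same transport read from `G′`: a class `c′ ∈ Irr(G′)` is a constituent of `ρ ∘ e` iff its push-forward
`comap e⁻¹ c′ ∈ Irr(G)` is a constituent of `ρ`. [cite: Rogawski1990, §12.2 p. 173] -/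
theorem isConstituentOf_comp_iff_comap_symm (e : G' ≃ₜ* G) {V : Type*} [AddCommGroup V] [Module ℂ V]
    (ρ : Representation ℂ G V) (c' : IrrClass G') :
    c'.IsConstituentOf (ρ.comp (e : G' →* G)) ↔ (comap e.symm c').IsConstituentOf ρ := by
  rw [← comap_isConstituentOf_comp_iff e ρ (comap e.symm c'), comap_comap_symm]

/-- «Pull-back of a constituent of `ρ`» = «constituent of `ρ ∘ e`»: a class of `G′` is `comap e c₀` for some constituent `c₀`
of `ρ` iff it is a constituent of `ρ ∘ e` (transport + `comap e` onto) — the shape in which the non-split local A-packet of an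
inner form lists its members. [cite: Rogawski1990, §12.2 p. 173] -/
theorem exists_eq_comap_and_isConstituentOf_iff (e : G' ≃ₜ* G) {V : Type*} [AddCommGroup V] [Module ℂ V]
    (ρ : Representation ℂ G V) (c' : IrrClass G') :
    (∃ c₀ : IrrClass G, c' = comap e c₀ ∧ c₀.IsConstituentOf ρ) ↔ c'.IsConstituentOf (ρ.comp (e : G' →* G)) := by
  rw [exists_eq_comap_iff, isConstituentOf_comp_iff_comap_symm]

end IrrClass

end Literature.NumberTheory.Automorphic

end
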